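import Summits.QuantumFields.YangMills.Theorems.BalabanUVNodesN15VectorPiecePlain
import Summits.QuantumFields.YangMills.Theorems.BalabanUVNodesN15VectorPieceSized
import Summits.QuantumFields.YangMills.Theorems.BalabanUVNodesN15BackgroundLayerFull
import HarnessLib

/-!
# Route «BalabanUVNodes» (K4 «SpineRates»), node N15 = NE2, part 27 — THE JOINT -a∕-b KNIT: `T4EtaRate.NE2PlusOperator` BY NAME for the U = 1 vector
# single-scale piece DRESSED BY THE ZEROTH-ORDER BACKGROUND SPECIES — background block LIVE ((3.35) consumed), size guard LIVE, every U ≡ 1 input a tree theorem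

Cell `pub-ymgap`, seat `pub-ymgap-dag-n15-a` (KNIT-BY-NAME, generation g5; HUMAN RULING D-0062; chair R424 venue; `bears_on: R4∕N15`).  Filed
`--supports stmt-QuantumFields-19676` (helper; K3 «SpineGivenEndpointR11»).  Plumbing: the sized [B6] unit-torus carrier (`unitTorusGeoS`: `unitTorusGeo` with the
size field set), the four level-`n` piece builders (`pieceG`, `pieceD1`, `pieceS`, `pieceD3`), the rate number `thetaV`, the realised background instance ∕ family
(`bgVecInstance`, `bgVecFamily`); then theorems.  Imports BY NAME, nothing in the tree modified: -a parts 26 (`hasMaj_plain_all`), 25 (`VecIndexS`), 23∕16∕15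
(`hasMaj_entry3`, `hasMaj_threeEntries`, `hasMaj_entry0`, the plumbing `reH`∕`reD`∕`reLap`∕`covC`∕`wTranspose`∕`rweight`∕`blkFine`∕`kingPrV`, `inv_pow_le_rpow`) and
-b part A4 (`…N15.BackgroundLayer.ne2PlusOperator_background4`, `bgInstance`, `bgFamily4`; transitively A1–A3: `coeffBg`, `bgProp`, `bgDerived`, `bgSource`).

WHAT THIS IS (the «JOINT RESIDUE» of n15-b's A3∕A4 line and ref-B READ-342's table note (2), pub-ymgap INBOX).  n15-b's A4 proves `NE2PlusOperator` BY NAME for ANY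
family of data whose only displayed hypotheses are the U ≡ 1 LAYER: five plain majorants `β·e^{−δd}` (coarse `G`, `S = G∂_ν*`; fine `G′`, `D₁′ = ∂′_νG′`,
`D₃′ = (Δ′−∂′∂′*)G′`) and four η-defects `m₀·θ·e^{−δd}` (`𝔇(G′,G)`, `𝔇(D₁′,D₁)`, `𝔇(S′,S)`, `𝔇(D₃′,D₃)`) with `θ ≤ (L^j)^{−γ}`.  The -a chain proves exactly
these for the U = 1 vector single-scale piece `G = H_k·C^{(k)}·(η^{d+1}H_kᵀ)` on the unit-torus carrier: plain = part 26, defects = parts 15∕16∕23.  This file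
PLUGS THEM IN.  Data of the realised family, index `j : VecIndexS d L` (unit torus `Π ℤ∕M_ν` with `L ∣ M_ν`, levels `k`, `m ≥ 1`, direction `ν`, size `M ≥ 1`):
carrier `unitTorusGeoS L j.k j.Mn j.Msz` (so the fine instance's [B9] size parameter IS `j.Msz` — `bgVecInstance_gf_M`; the guard `M₅ ≤ M` and the smallness
`M·α₀ ≤ a₀` are LIVE, and `M` multiplies `α₀` inside the (3.35) letters of the coefficient carrier `coeffBg`: `|c′| ≤ c₃₅·M·α₀`, `FibreOsc π c′ (c₃₅·M·α₀·θ)`),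
blocks `blkFine`, King's pairing `kingPrV`, scale shift `m`, rate number `θ_j = (L^k)^{−¼}` (`γ = ¼`: entries 1–2 carry `(L^k)^{−¼}` at `α = γ = ½`, entries 0∕3
the full `(L^k)⁻¹ ≤ (L^k)^{−¼}`), background carriers = n15-b's coefficient fields with `Reg335` = the (3.35) letter pair, transport = block average.

CONTENTS.
* §1 `unitTorusGeoS` (+ `_dist`, `_M`, `rateWeight_unitTorusGeoS`), `pieceG`∕`pieceD1`∕`pieceS`∕`pieceD3`, `entry0_eq_idef`∕`entry1_eq_idef`∕`entry2_eq_idef`∕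
  `entry3_eq_idef` (`rfl`: parts 15∕23's entries ARE the η-defects of these pieces), `thetaV`, `bgVecInstance`, `bgVecFamily`, **`bgVecInstance_gf_M`** (`rfl`:
  guard = `j.Msz`, LIVE), `reg335_bgVec_iff` (what (3.35) says here).
* §2 **`uniform_layer_vectorPiece`**: ONE `(β, δ, m₀) ` with `0 < δ` such that all five plain majorants and all four defects hold at every sized index (parts 26 + 15∕16∕23
  read at the common rate `δ := min(δ_p, δ₁, δ₀, δ₃)`).
* §3 **`ne2PlusOperator_vectorPiece_background`**: for `d + 1 ≥ 2`, `L ≥ 1` and every `c₃₅ > 0`,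
  `T4EtaRate.NE2PlusOperator c₃₅ (bgVecInstance hL) (bgVecFamily hL)` — A4 instantiated; `_dim4`.

HONEST FRAMING ∕ LIMITS.  A knit: no new estimate (every analytic input is a landed theorem of the -a∕-b chains).  What the statement covers: the LINEAR (U = 1) vector
piece of [B5]∕[B6]∕King (4.42) dressed by n15-b's ZEROTH-ORDER abelian coefficient species `V′ = M_{c′}` of [B9] (3.50)–(3.53) with linearised block-average
transport — NOT Bałaban's full `G(U)` (the first-order species and the non-abelian transport are n15-b's B-series; NE2⁺ for `G(U)` beyond this model NOT PRINTED ∕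
not proved); one single-scale piece, NOT the multiscale carrier ∕ telescoping over `j` (NODE 00).  Count-neutral (typed 28∕28 · discharged unchanged); NOT a
discharge of N15; one finite T⁴ at fixed ε — NOT infinite volume, NOT OS on ℝ⁴, NOT a mass gap, NOT Clay.
-/

noncomputable section

open scoped BigOperators
open Finset

namespace Summit.QuantumFields.YangMills.BalabanUVNodes.N15.VectorPiece

open Literature.MathematicalPhysics.QuantumFieldTheory.Balaban1983to89
open Literature.MathematicalPhysics.QuantumFieldTheory.Balaban1983to89.B11SectG (BlockNorm HasMaj RowSum)
open Literature.MathematicalPhysics.QuantumFieldTheory.Balaban1983to89.B6RandomWalk (Triangle254)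
open Literature.MathematicalPhysics.QuantumFieldTheory.Balaban1983to89.T4EtaRate (PairedInstance NE2PlusOperator)
open Literature.MathematicalPhysics.QuantumFieldTheory.Balaban1983to89.T4EtaRateDefect (idef rateWeight)
open Literature.MathematicalPhysics.QuantumFieldTheory.Balaban1983to89.T4EtaRateCoeffDefect (pull FibreOsc)
open Literature.MathematicalPhysics.QuantumFieldTheory.Balaban1983to89.B5Prop11Plancherel (Tor fine)
open Literature.MathematicalPhysics.QuantumFieldTheory.Balaban1983to89.B6UnitTorusCarrier (unitTorusGeo unitTorusGeo_len triangle254_unitTorusGeo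
  rowSum_unitTorusGeo)
open Literature.MathematicalPhysics.QuantumFieldTheory.King1986.Torus (tdistT tdistT_nonneg)
open Summit.QuantumFields.YangMills.BalabanUVNodes.N15.BackgroundLayer (coeffBg bgInstance bgFamily4 ne2PlusOperator_background4)

variable {d : ℕ}

/-! ## §1 The sized carrier, the U ≡ 1 pieces, the realised background instance family -/

section Data

/-- THE SIZED [B6] UNIT-TORUS CARRIER: `B6UnitTorusCarrier.unitTorusGeo` with Bałaban's size parameter set to `Msz` (every other field — sites, King's
distance, `k`, `η = L^{−k}`, `L` — unchanged). [cite: Balaban1985BackgroundPropagators, Thm 3.1 p.397 («for M ≥ M₁»: the size parameter)] -/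
@[reducible] def unitTorusGeoS (L k : ℕ) (M : Fin (d + 1) → ℕ) [∀ μ, NeZero (M μ)] (Msz : ℝ) : B6.Geometry :=
  { unitTorusGeo L k M with M := Msz }

variable (L : ℕ) (M : Fin (d + 1) → ℕ) [∀ μ, NeZero (M μ)]

/-- The sized carrier's distance is King's periodic sup-distance. [folklore] -/
theorem unitTorusGeoS_dist (k : ℕ) (Msz : ℝ) (y y' : Tor M) : (unitTorusGeoS L k M Msz).dist y y' = tdistT M y y' := rfl

/-- The sized carrier's size field. [folklore] -/
theorem unitTorusGeoS_M (k : ℕ) (Msz : ℝ) : (unitTorusGeoS L k M Msz).M = Msz := rfl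

/-- The defect calculus' rate weight on the sized carrier is `(L^k)^{−γ}` at every site. [folklore] -/
theorem rateWeight_unitTorusGeoS (k : ℕ) (Msz γ : ℝ) (y : Tor M) : rateWeight (unitTorusGeoS L k M Msz) γ y = ((L : ℝ) ^ k) ^ (-γ) := rfl

variable (n kk : ℕ) [NeZero n] (w : ℝ)

/-- THE LEVEL-`n` PROPAGATOR PIECE `G = H·C^{(kk)}·(w·Hᵀ)` (King's (4.42) piece with Bałaban's vector factors; `n = L^k`, `w = η^{d+1}` coarse; `n = L^mL^k`,
`w = η^{d+1}∕(L^m)^{d+1}` fine). [cite: King1986, (4.42) p.675 (the piece); Balaban1984PropagatorsI, (1.63) p.28; Balaban1984PropagatorsII, (2.156) p.250] -/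
def pieceG : (Tor (fine n M) × Fin (d + 1) → ℝ) →ₗ[ℝ] (Tor (fine n M) × Fin (d + 1) → ℝ) :=
  reH M n ∘ₗ (covC L M (L ^ kk) ∘ₗ wTranspose M n w (reH M n))

/-- THE DERIVED PIECE `∂_νG`. [cite: Balaban1985BackgroundPropagators, (3.42) p.397 (second entry, shape)] -/
def pieceD1 (ν : Fin (d + 1)) : (Tor (fine n M) × Fin (d + 1) → ℝ) →ₗ[ℝ] (Tor (fine n M) × Fin (d + 1) → ℝ) :=
  reD M n ν ∘ₗ (covC L M (L ^ kk) ∘ₗ wTranspose M n w (reH M n))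

/-- THE SOURCE PIECE `G∂_ν*` (right factor the weighted transpose of `∂_νH`). [cite: Balaban1985BackgroundPropagators, (3.42) p.397 (third entry, shape)] -/
def pieceS (ν : Fin (d + 1)) : (Tor (fine n M) × Fin (d + 1) → ℝ) →ₗ[ℝ] (Tor (fine n M) × Fin (d + 1) → ℝ) :=
  reH M n ∘ₗ (covC L M (L ^ kk) ∘ₗ wTranspose M n w (reD M n ν))

/-- THE LAPLACIAN PIECE `(Δ−∂∂*)G`. [cite: Balaban1985BackgroundPropagators, (3.42) p.397 (fourth entry, shape); Balaban1984PropagatorsI, (1.69) p.29] -/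
def pieceD3 : (Tor (fine n M) × Fin (d + 1) → ℝ) →ₗ[ℝ] (Tor (fine n M) × Fin (d + 1) → ℝ) :=
  reLap M n ∘ₗ (covC L M (L ^ kk) ∘ₗ wTranspose M n w (reH M n))

variable [NeZero L] (k m : ℕ)

/-- Part 15's ENTRY 0 is the η-defect of the fine and coarse propagator pieces through King's pairing. [folklore] -/
theorem entry0_eq_idef : entry0 (d := d) L k m M = idef (pull (kingPrV L k m M)) (pull (kingPrV L k m M))
    (pieceG L M (L ^ m * L ^ k) (k + m) (rweight (d := d) L k / ((L : ℝ) ^ m) ^ (d + 1))) (pieceG L M (L ^ k) k (rweight (d := d) L k)) := rfl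

/-- Part 15's ENTRY 1 is the η-defect of the derived pieces. [folklore] -/
theorem entry1_eq_idef (ν : Fin (d + 1)) : entry1 (d := d) L k m M ν = idef (pull (kingPrV L k m M)) (pull (kingPrV L k m M))
    (pieceD1 L M (L ^ m * L ^ k) (k + m) (rweight (d := d) L k / ((L : ℝ) ^ m) ^ (d + 1)) ν) (pieceD1 L M (L ^ k) k (rweight (d := d) L k) ν) := rfl

/-- Part 15's ENTRY 2 is the η-defect of the source pieces. [folklore] -/
theorem entry2_eq_idef (ν : Fin (d + 1)) : entry2 (d := d) L k m M ν = idef (pull (kingPrV L k m M)) (pull (kingPrV L k m M))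
    (pieceS L M (L ^ m * L ^ k) (k + m) (rweight (d := d) L k / ((L : ℝ) ^ m) ^ (d + 1)) ν) (pieceS L M (L ^ k) k (rweight (d := d) L k) ν) := rfl

/-- Part 23's ENTRY 3 is the η-defect of the Laplacian pieces. [folklore] -/
theorem entry3_eq_idef : entry3 (d := d) L k m M = idef (pull (kingPrV L k m M)) (pull (kingPrV L k m M))
    (pieceD3 L M (L ^ m * L ^ k) (k + m) (rweight (d := d) L k / ((L : ℝ) ^ m) ^ (d + 1))) (pieceD3 L M (L ^ k) k (rweight (d := d) L k)) := rfl

end Data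

section Family

variable (L : ℕ) [NeZero L]

/-- THE RATE NUMBER of a sized index: `θ_j = (L^k)^{−¼}` (the exponent the -a chain's four entries share: `¼` from entries 1–2 at `α = γ = ½`). [folklore] -/
def thetaV (j : VecIndexS d L) : ℝ := ((L : ℝ) ^ j.k) ^ (-(1 / 4 : ℝ))

omit [NeZero L] in
/-- `L ≠ 0` as a real number, for the sized carrier's `L` field. [folklore] -/
theorem unitTorusGeoS_L_ne_zero (hL : 1 ≤ L) (j : VecIndexS d L) : (unitTorusGeoS L j.k j.Mn j.Msz).L ≠ 0 :=
  Nat.cast_ne_zero.mpr (by omega)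

/-- THE REALISED BACKGROUND INSTANCE at a sized index: n15-b's `bgInstance` over the SIZED unit-torus carrier, blocks `blkFine`, King's pairing, scale shift `m`,
rate number `θ_j` (coarse and fine coefficient carriers = the (3.35) letter pair with the index's `M`). [cite: Balaban1985BackgroundPropagators, Thm 3.14 pp.426–427 (typing template); (3.35) p.396] -/
def bgVecInstance (hL : 1 ≤ L) (j : VecIndexS d L) : PairedInstance :=
  bgInstance (g := unitTorusGeoS L j.k j.Mn j.Msz) (blkFine L j.k j.Mn) (kingPrV L j.k j.m j.Mn) j.m (unitTorusGeoS_L_ne_zero L hL j) (thetaV L j) (thetaV L j)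

/-- THE REALISED KERNEL FAMILY: n15-b's `bgFamily4` (all four (3.42) entries of the background-dependent pair CONSTRUCTED from the U ≡ 1 pieces by the fixed-point
equation (3.65), A1∕A3) fed with the -a pieces of the vector single-scale piece at the index (direction `ν` for entries 1–2). [cite: Balaban1985BackgroundPropagators, (3.42) p.397, (3.63)–(3.65) pp.402–403 (shapes, mechanism)] -/
def bgVecFamily (hL : 1 ≤ L) (j : VecIndexS d L) : B9.KernelFamily (bgVecInstance (d := d) L hL j).gc (bgVecInstance (d := d) L hL j).Bf :=
  bgFamily4 (g := unitTorusGeoS L j.k j.Mn j.Msz) (blkFine L j.k j.Mn) (kingPrV L j.k j.m j.Mn) j.m (unitTorusGeoS_L_ne_zero L hL j) (thetaV L j) (thetaV L j)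
    (pieceG L j.Mn (L ^ j.k) j.k (rweight (d := d) L j.k)) (pieceD1 L j.Mn (L ^ j.k) j.k (rweight (d := d) L j.k) j.ν)
    (pieceS L j.Mn (L ^ j.k) j.k (rweight (d := d) L j.k) j.ν) (pieceD3 L j.Mn (L ^ j.k) j.k (rweight (d := d) L j.k))
    (pieceG L j.Mn (L ^ j.m * L ^ j.k) (j.k + j.m) (rweight (d := d) L j.k / ((L : ℝ) ^ j.m) ^ (d + 1)))
    (pieceD1 L j.Mn (L ^ j.m * L ^ j.k) (j.k + j.m) (rweight (d := d) L j.k / ((L : ℝ) ^ j.m) ^ (d + 1)) j.ν)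
    (pieceS L j.Mn (L ^ j.m * L ^ j.k) (j.k + j.m) (rweight (d := d) L j.k / ((L : ℝ) ^ j.m) ^ (d + 1)) j.ν)
    (pieceD3 L j.Mn (L ^ j.m * L ^ j.k) (j.k + j.m) (rweight (d := d) L j.k / ((L : ℝ) ^ j.m) ^ (d + 1)))

/-- **THE GUARD IS LIVE**: the fine realised instance's [B9] size parameter IS the index's `M` (n15-b's `bgInstance_M` on the sized carrier) — and the index family
has unbounded `M` (part 25 `exists_vecIndexS_size_ge`). [folklore] -/
theorem bgVecInstance_gf_M (hL : 1 ≤ L) (j : VecIndexS d L) : (bgVecInstance (d := d) L hL j).gf.M = j.Msz := rfl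

/-- WHAT (3.35) SAYS HERE: a fine coefficient field `c′` is `Reg335 c₃₅ α₀`-regular iff `|c′| ≤ c₃₅·M·α₀` pointwise and its oscillation over every King fibre is
`≤ c₃₅·M·α₀·θ_j` — the printed letter pair «|A| < O(1)Mα₀(L^jη)^{−1}, |∇^ηA| < O(1)Mα₀(L^jη)^{−2} on □» read blockwise, with the index's OWN `M`.
[cite: Balaban1985BackgroundPropagators, (3.35) p.396] -/
theorem reg335_bgVec_iff (hL : 1 ≤ L) (j : VecIndexS d L) (c35 α₀ : ℝ) (c' : Tor (fine (L ^ j.m * L ^ j.k) j.Mn) × Fin (d + 1) → ℝ) :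
    (bgVecInstance (d := d) L hL j).Bf.Reg335 c35 α₀ c' ↔
      (∀ x', |c' x'| ≤ c35 * j.Msz * α₀) ∧ FibreOsc (kingPrV L j.k j.m j.Mn) c' (fun _ => c35 * j.Msz * α₀ * thetaV L j) :=
  Iff.rfl

end Family

/-! ## §2 The U ≡ 1 layer of the vector piece at ONE uniform `(β, δ, m₀)`, on the sized carriers -/

section Layer

variable {L : ℕ} [NeZero L]

/-- **THE UNIFORM U ≡ 1 LAYER.**  For `d + 1 ≥ 2`, `L ≥ 1` there are `β, δ, m₀ > 0` such that at every sized index: the five plain majorants `β·e^{−δ|y−y′|_T}` of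
`G`, `G′`, `G∂_ν*`, `∂′_νG′`, `(Δ′−∂′∂′*)G′` (part 26) and the four η-defects `m₀·θ_j·e^{−δ|y−y′|_T}` of `(G′,G)`, `(∂′_νG′,∂_νG)`, `(G′∂′_ν*,G∂_ν*)`,
`((Δ′−∂′∂′*)G′,(Δ−∂∂*)G)` (parts 15∕16∕23 read at `θ_j = (L^k)^{−¼}`) hold on the sized carrier — all nine at ONE decay rate.
[cite: King1986, (4.42)–(4.43) p.675 (mechanism); Balaban1985BackgroundPropagators, (3.42) p.397 (shape)] -/
theorem uniform_layer_vectorPiece (hd : 1 ≤ d) (hL : 1 ≤ L) :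
    ∃ β δ m₀ : ℝ, 0 < β ∧ 0 < δ ∧ 0 < m₀ ∧ ∀ j : VecIndexS d L,
      HasMaj (BlockNorm.ofBlocks (unitTorusGeoS L j.k j.Mn j.Msz) (blkFine L j.k j.Mn)) (BlockNorm.ofBlocks (unitTorusGeoS L j.k j.Mn j.Msz) (blkFine L j.k j.Mn))
          (pieceG L j.Mn (L ^ j.k) j.k (rweight (d := d) L j.k)) (fun y y' => β * Real.exp (-(δ * (unitTorusGeoS L j.k j.Mn j.Msz).dist y y')))
      ∧ HasMaj (BlockNorm.ofBlocks (unitTorusGeoS L j.k j.Mn j.Msz) (blkFine L j.k j.Mn ∘ kingPrV L j.k j.m j.Mn))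
          (BlockNorm.ofBlocks (unitTorusGeoS L j.k j.Mn j.Msz) (blkFine L j.k j.Mn ∘ kingPrV L j.k j.m j.Mn))
          (pieceG L j.Mn (L ^ j.m * L ^ j.k) (j.k + j.m) (rweight (d := d) L j.k / ((L : ℝ) ^ j.m) ^ (d + 1)))
          (fun y y' => β * Real.exp (-(δ * (unitTorusGeoS L j.k j.Mn j.Msz).dist y y')))
      ∧ HasMaj (BlockNorm.ofBlocks (unitTorusGeoS L j.k j.Mn j.Msz) (blkFine L j.k j.Mn)) (BlockNorm.ofBlocks (unitTorusGeoS L j.k j.Mn j.Msz) (blkFine L j.k j.Mn))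
          (pieceS L j.Mn (L ^ j.k) j.k (rweight (d := d) L j.k) j.ν) (fun y y' => β * Real.exp (-(δ * (unitTorusGeoS L j.k j.Mn j.Msz).dist y y')))
      ∧ HasMaj (BlockNorm.ofBlocks (unitTorusGeoS L j.k j.Mn j.Msz) (blkFine L j.k j.Mn ∘ kingPrV L j.k j.m j.Mn))
          (BlockNorm.ofBlocks (unitTorusGeoS L j.k j.Mn j.Msz) (blkFine L j.k j.Mn ∘ kingPrV L j.k j.m j.Mn))
          (pieceD1 L j.Mn (L ^ j.m * L ^ j.k) (j.k + j.m) (rweight (d := d) L j.k / ((L : ℝ) ^ j.m) ^ (d + 1)) j.ν)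
          (fun y y' => β * Real.exp (-(δ * (unitTorusGeoS L j.k j.Mn j.Msz).dist y y')))
      ∧ HasMaj (BlockNorm.ofBlocks (unitTorusGeoS L j.k j.Mn j.Msz) (blkFine L j.k j.Mn ∘ kingPrV L j.k j.m j.Mn))
          (BlockNorm.ofBlocks (unitTorusGeoS L j.k j.Mn j.Msz) (blkFine L j.k j.Mn ∘ kingPrV L j.k j.m j.Mn))
          (pieceD3 L j.Mn (L ^ j.m * L ^ j.k) (j.k + j.m) (rweight (d := d) L j.k / ((L : ℝ) ^ j.m) ^ (d + 1)))
          (fun y y' => β * Real.exp (-(δ * (unitTorusGeoS L j.k j.Mn j.Msz).dist y y')))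
      ∧ HasMaj (BlockNorm.ofBlocks (unitTorusGeoS L j.k j.Mn j.Msz) (blkFine L j.k j.Mn))
          (BlockNorm.ofBlocks (unitTorusGeoS L j.k j.Mn j.Msz) (blkFine L j.k j.Mn ∘ kingPrV L j.k j.m j.Mn))
          (idef (pull (kingPrV L j.k j.m j.Mn)) (pull (kingPrV L j.k j.m j.Mn))
            (pieceG L j.Mn (L ^ j.m * L ^ j.k) (j.k + j.m) (rweight (d := d) L j.k / ((L : ℝ) ^ j.m) ^ (d + 1))) (pieceG L j.Mn (L ^ j.k) j.k (rweight (d := d) L j.k)))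
          (fun y y' => m₀ * thetaV L j * Real.exp (-(δ * (unitTorusGeoS L j.k j.Mn j.Msz).dist y y')))
      ∧ HasMaj (BlockNorm.ofBlocks (unitTorusGeoS L j.k j.Mn j.Msz) (blkFine L j.k j.Mn))
          (BlockNorm.ofBlocks (unitTorusGeoS L j.k j.Mn j.Msz) (blkFine L j.k j.Mn ∘ kingPrV L j.k j.m j.Mn))
          (idef (pull (kingPrV L j.k j.m j.Mn)) (pull (kingPrV L j.k j.m j.Mn))
            (pieceD1 L j.Mn (L ^ j.m * L ^ j.k) (j.k + j.m) (rweight (d := d) L j.k / ((L : ℝ) ^ j.m) ^ (d + 1)) j.ν)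
            (pieceD1 L j.Mn (L ^ j.k) j.k (rweight (d := d) L j.k) j.ν))
          (fun y y' => m₀ * thetaV L j * Real.exp (-(δ * (unitTorusGeoS L j.k j.Mn j.Msz).dist y y')))
      ∧ HasMaj (BlockNorm.ofBlocks (unitTorusGeoS L j.k j.Mn j.Msz) (blkFine L j.k j.Mn))
          (BlockNorm.ofBlocks (unitTorusGeoS L j.k j.Mn j.Msz) (blkFine L j.k j.Mn ∘ kingPrV L j.k j.m j.Mn))
          (idef (pull (kingPrV L j.k j.m j.Mn)) (pull (kingPrV L j.k j.m j.Mn))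
            (pieceS L j.Mn (L ^ j.m * L ^ j.k) (j.k + j.m) (rweight (d := d) L j.k / ((L : ℝ) ^ j.m) ^ (d + 1)) j.ν)
            (pieceS L j.Mn (L ^ j.k) j.k (rweight (d := d) L j.k) j.ν))
          (fun y y' => m₀ * thetaV L j * Real.exp (-(δ * (unitTorusGeoS L j.k j.Mn j.Msz).dist y y')))
      ∧ HasMaj (BlockNorm.ofBlocks (unitTorusGeoS L j.k j.Mn j.Msz) (blkFine L j.k j.Mn))
          (BlockNorm.ofBlocks (unitTorusGeoS L j.k j.Mn j.Msz) (blkFine L j.k j.Mn ∘ kingPrV L j.k j.m j.Mn))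
          (idef (pull (kingPrV L j.k j.m j.Mn)) (pull (kingPrV L j.k j.m j.Mn))
            (pieceD3 L j.Mn (L ^ j.m * L ^ j.k) (j.k + j.m) (rweight (d := d) L j.k / ((L : ℝ) ^ j.m) ^ (d + 1))) (pieceD3 L j.Mn (L ^ j.k) j.k (rweight (d := d) L j.k)))
          (fun y y' => m₀ * thetaV L j * Real.exp (-(δ * (unitTorusGeoS L j.k j.Mn j.Msz).dist y y'))) := by
  obtain ⟨βp, δp, hβp, hδp, HP⟩ := hasMaj_plain_all (d := d) (L := L) hd hL
  obtain ⟨B₀, δ₀, hB₀, hδ₀, H0⟩ := hasMaj_entry0 (d := d) (L := L) hd hL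
  obtain ⟨B₁, δ₁, hB₁, hδ₁, H12⟩ := hasMaj_threeEntries (d := d) (L := L) hd hL (α := 1 / 2) (γ := 1 / 2) (by norm_num) (by norm_num) (by norm_num)
    (by norm_num)
  obtain ⟨B₃, δ₃, hB₃, hδ₃, H3⟩ := hasMaj_entry3 (d := d) (L := L) hd hL
  have hmin : min (1 / 2 : ℝ) (1 / 2) / 2 = 1 / 4 := by norm_num
  rw [hmin] at H12
  set δ : ℝ := min (min δp δ₀) (min δ₁ δ₃) with hδ
  have hδ0 : 0 < δ := lt_min (lt_min hδp hδ₀) (lt_min hδ₁ hδ₃)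
  have hδp' : δ ≤ δp := (min_le_left _ _).trans (min_le_left _ _)
  have hδ₀' : δ ≤ δ₀ := (min_le_left _ _).trans (min_le_right _ _)
  have hδ₁' : δ ≤ δ₁ := (min_le_right _ _).trans (min_le_left _ _)
  have hδ₃' : δ ≤ δ₃ := (min_le_right _ _).trans (min_le_right _ _)
  set m₀ : ℝ := max (max B₀ B₁) B₃ with hm₀
  have hm₀0 : 0 < m₀ := lt_max_of_lt_right hB₃
  refine ⟨βp, δ, m₀, hβp, hδ0, hm₀0, fun j => ?_⟩
  obtain ⟨hG, hG', hS, hD1', hD3'⟩ := HP j.Mn j.dvd j.k j.m j.ν hδ0.le hδp'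
  have hx0 : (0 : ℝ) < (L : ℝ) ^ j.k := pow_pos (by exact_mod_cast (show 0 < L by omega)) _
  have hθ0 : 0 ≤ thetaV L j := Real.rpow_nonneg hx0.le _
  -- the two rates the -a entries carry, dominated by `m₀·θ_j`
  have hrate1 : ∀ {B : ℝ}, B ≤ m₀ → ∀ y y' : Tor j.Mn,
      B * ((L : ℝ) ^ j.k)⁻¹ * Real.exp (-(δ * tdistT j.Mn y y')) ≤ m₀ * thetaV L j * Real.exp (-(δ * tdistT j.Mn y y')) := fun hB y y' =>
    mul_le_mul_of_nonneg_right (mul_le_mul hB (inv_pow_le_rpow hL j.k (by norm_num)) (inv_nonneg.mpr hx0.le) hm₀0.le) (Real.exp_nonneg _)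
  have hrate4 : ∀ {B : ℝ}, B ≤ m₀ → ∀ y y' : Tor j.Mn,
      B * ((L : ℝ) ^ j.k) ^ (-(1 / 4 : ℝ)) * Real.exp (-(δ * tdistT j.Mn y y')) ≤ m₀ * thetaV L j * Real.exp (-(δ * tdistT j.Mn y y')) := fun hB y y' =>
    mul_le_mul_of_nonneg_right (mul_le_mul_of_nonneg_right hB hθ0) (Real.exp_nonneg _)
  obtain ⟨h₀, h₁, h₂⟩ := H12 j.Mn j.dvd j.k j.m j.one_le j.ν
  refine ⟨hG, hG', hS, hD1', hD3', ?_, ?_, ?_, ?_⟩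
  · exact (H0 j.Mn j.dvd j.k j.m j.one_le hδ0.le hδ₀').mono (hrate1 ((le_max_left _ _).trans (le_max_left _ _)))
  · -- entry 1 is stated at the rate `δ₁`; weaken its decay to `δ` first
    refine h₁.mono fun y y' => (le_trans ?_ (hrate4 ((le_max_right _ _).trans (le_max_left _ _)) y y'))
    exact mul_le_mul_of_nonneg_left (Real.exp_le_exp.mpr (neg_le_neg (mul_le_mul_of_nonneg_right hδ₁' (tdistT_nonneg _ _ _))))
      (mul_nonneg hB₁.le (Real.rpow_nonneg hx0.le _))
  · refine h₂.mono fun y y' => (le_trans ?_ (hrate4 ((le_max_right _ _).trans (le_max_left _ _)) y y'))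
    exact mul_le_mul_of_nonneg_left (Real.exp_le_exp.mpr (neg_le_neg (mul_le_mul_of_nonneg_right hδ₁' (tdistT_nonneg _ _ _))))
      (mul_nonneg hB₁.le (Real.rpow_nonneg hx0.le _))
  · exact (H3 j.Mn j.dvd j.k j.m j.one_le hδ0.le hδ₃').mono (hrate1 (le_max_right _ _))

end Layer

/-! ## §3 THE KNIT: `NE2PlusOperator` BY NAME, background block live, size guard live, every U ≡ 1 input a tree theorem -/

section Knit

variable {L : ℕ} [NeZero L]

/-- **NE2⁺, OPERATOR LAYER — THE NODE's FIRST CONJUNCT `T4EtaRate.NE2PlusOperator` BY NAME FOR THE U = 1 VECTOR SINGLE-SCALE PIECE DRESSED BY THE ZEROTH-ORDER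
BACKGROUND SPECIES**, on the realised family indexed by the sized indices: (3.35) CONSUMED (the coefficient carrier's `Reg335` supplies the sup and oscillation letters,
the guard `M·α₀ ≤ a₀` the contraction), the size guard `M₅ ≤ M` LIVE (`bgVecInstance_gf_M`, unbounded `M`), all four (3.42) entries of the background-dependent pair
CONSTRUCTED (n15-b A1∕A3), and EVERY U ≡ 1 input a landed theorem of the -a chain (§2).  n15-b's A4 `ne2PlusOperator_background4` instantiated.
[cite: Balaban1985BackgroundPropagators, Thm 3.1 p.397 (quantifier template), (3.35) p.396, (3.42) p.397, (3.63)–(3.65) pp.402–403 (shapes, mechanism); King1986, (4.42)–(4.43) p.675, Prop. 3.9 (3.73) p.665 (A = 0 model, rate factor)] -/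
theorem ne2PlusOperator_vectorPiece_background (hd : 1 ≤ d) (hL : 1 ≤ L) (c35 : ℝ) (hc35 : 0 < c35) :
    NE2PlusOperator c35 (bgVecInstance (d := d) L hL) (bgVecFamily (d := d) L hL) := by
  obtain ⟨β, δ, m₀, hβ, hδ, hm₀, H⟩ := uniform_layer_vectorPiece (d := d) (L := L) hd hL
  have hL0 : L ≠ 0 := by omega
  have hLr : (0 : ℝ) < (L : ℝ) := by exact_mod_cast (show 0 < L by omega)
  have hσ : 0 < δ / 2 := half_pos hδ
  exact ne2PlusOperator_background4 (I := VecIndexS d L) (fun j => unitTorusGeoS L j.k j.Mn j.Msz)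
    (fun j => Tor (fine (L ^ j.k) j.Mn) × Fin (d + 1)) (fun j => Tor (fine (L ^ j.m * L ^ j.k) j.Mn) × Fin (d + 1))
    (fun j => blkFine L j.k j.Mn) (fun j => kingPrV L j.k j.m j.Mn) (fun j => j.m) (fun j => unitTorusGeoS_L_ne_zero L hL j) (thetaV L) (thetaV L)
    (fun j => pieceG L j.Mn (L ^ j.k) j.k (rweight (d := d) L j.k)) (fun j => pieceD1 L j.Mn (L ^ j.k) j.k (rweight (d := d) L j.k) j.ν)
    (fun j => pieceS L j.Mn (L ^ j.k) j.k (rweight (d := d) L j.k) j.ν) (fun j => pieceD3 L j.Mn (L ^ j.k) j.k (rweight (d := d) L j.k))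
    (fun j => pieceG L j.Mn (L ^ j.m * L ^ j.k) (j.k + j.m) (rweight (d := d) L j.k / ((L : ℝ) ^ j.m) ^ (d + 1)))
    (fun j => pieceD1 L j.Mn (L ^ j.m * L ^ j.k) (j.k + j.m) (rweight (d := d) L j.k / ((L : ℝ) ^ j.m) ^ (d + 1)) j.ν)
    (fun j => pieceS L j.Mn (L ^ j.m * L ^ j.k) (j.k + j.m) (rweight (d := d) L j.k / ((L : ℝ) ^ j.m) ^ (d + 1)) j.ν)
    (fun j => pieceD3 L j.Mn (L ^ j.m * L ^ j.k) (j.k + j.m) (rweight (d := d) L j.k / ((L : ℝ) ^ j.m) ^ (d + 1)))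
    c35 hc35 (fun j => triangle254_unitTorusGeo L j.k j.Mn) (fun j a b => tdistT_nonneg _ _ _) hσ.le
    (B4Sect5Proof.latticeConst_nonneg (d + 1) hσ.le) (fun j => rowSum_unitTorusGeo L j.k j.Mn hσ)
    (fun j => inv_pos.mpr (pow_pos hLr _)) (fun j => hLr) (fun j y => (unitTorusGeo_len L j.k j.Mn hL0 y).symm.le)
    (by linarith) hβ.le hm₀.le (by norm_num : (0 : ℝ) < 1 / 4) (fun j => Real.rpow_nonneg (pow_nonneg hLr.le _) _) (fun j y => le_rfl)
    (fun j => (H j).1) (fun j => (H j).2.1) (fun j => (H j).2.2.1) (fun j => (H j).2.2.2.1) (fun j => (H j).2.2.2.2.1)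
    (fun j => (H j).2.2.2.2.2.1) (fun j => (H j).2.2.2.2.2.2.1) (fun j => (H j).2.2.2.2.2.2.2.1) (fun j => (H j).2.2.2.2.2.2.2.2)

/-- The four-dimensional instance (`d + 1 = 4`). [cite: Balaban1985BackgroundPropagators, Thm 3.1 p.397 (quantifier template)] -/
theorem ne2PlusOperator_vectorPiece_background_dim4 {L : ℕ} [NeZero L] (hL : 1 ≤ L) (c35 : ℝ) (hc35 : 0 < c35) :
    NE2PlusOperator c35 (bgVecInstance (d := 3) L hL) (bgVecFamily (d := 3) L hL) :=
  ne2PlusOperator_vectorPiece_background (d := 3) (by norm_num) hL c35 hc35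

end Knit

end Summit.QuantumFields.YangMills.BalabanUVNodes.N15.VectorPiece

end
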